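import Literature.NumberTheory.GelbartRogawski1991.UnitaryDualPairThetaKernel
import Literature.NumberTheory.Weil1964.ThetaLift
import HarnessLib

/-!
# J.-S. Li 1992, Theorem 2.1 (Rallis' inner product formula in Weil's convergent range) — RESTATED over the
# tree's CONSTRUCTED theta lift of a unitary dual pair `(U(J_V), U(J_W))` with compact quotients

J.-S. Li, *Non-vanishing theorems for the cohomology of certain arithmetic quotients*, J. reine angew. Math. **428**
(1992) 177–217 [Li1992], §1 pp. 177–179 and §2 «Rallis' inner product formula» pp. 181–184 (GDZ scan
PPN243919689_0428, page images of printed pp. 178, 181–184 read for this file; the cell's shelf card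
`Li1992-Crelle428/CARD.md` and `LOCATORS-III.md` row III-7a carry the same verbatim text).

## The printed text (verbatim)

* p. 178 (3)–(4): «For each `φ ∈ S(X(A))` we set (3) `θ_φ(g, h) = θ(ω(gh)φ)` (`g ∈ G̃(A)`, `h ∈ G̃'(A)`) … Let `π` be a cusp
  form contained in `L²(G'(k)\G̃'(A))` … For each smooth `f ∈ H_π` the function (4)
  `θ^f_φ(g) = ∫_{G'(k)\G'(A)} θ_φ(g, h) f(h) dh` (`g ∈ G̃(A)`) is well defined … A trivial observation is that `θ^f_φ(g)` is
  non-zero if and only if its Petersson norm `‖θ^f_φ(g)‖` is non-zero.»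
* p. 179 (6)–(7): «`n = dim_D V`, `n' = dim_D V'`» … «`d = dim_k D`, `d₀ = dim_k D₀`, `ε = d₀/d`»; p. 177: case 2 =
  «a quadratic extension `F/k`» with «the Galois involution of `F/k`» (so `d = 2`, `d₀ = 1`, `ε = 1/2`).
* p. 181 (9): «`⟨θ^{f₁}_{φ₁}, θ^{f₂}_{φ₂}⟩ = ∫_{G(k)\G(A)} θ^{f₁}_{φ₁}(g) \overline{θ^{f₂}_{φ₂}(g)} dg`».
* p. 184, after (24): «where `⟨π(h) f₁, f₂⟩ = ∫_{G(k)\G̃'(A)} f₁(xh) \overline{f₂(x)} dx` is a matrix coefficient for `π`»;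
  (25): «`F_φ(i(h, 1)) = ⟨ω(h)φ₁, φ₂⟩` is a matrix coefficient of the Weil representation.»
* p. 184, **Theorem 2.1**: «Let `φ₁, φ₂ ∈ S(X(A))`; `f₁, f₂ ∈ π`. Assume `n > 2n' + 4ε − 2`. Then
  (26) `⟨θ^{f₁}_{φ₁}, θ^{f₂}_{φ₂}⟩ = ∫_{G̃'(A)} ⟨ω(h)φ₁, φ₂⟩ ⟨π(h) f₁, f₂⟩ dh`.»

## What this file states, and over which carriers

The tree already types Theorem 2.1 at DICTIONARY level over posited carriers
(`Literature.NumberTheory.Li1992.Li92Datum.RallisInnerProductFormula`, file `RallisInnerProduct.lean`: `ω`, `π`, the lift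
and the Haar integral are bare data of a hypothesis structure).  Here the SAME printed identity is stated over the tree's
CONSTRUCTED objects:

* §1 (generic, definitions with bodies; nothing asserted): for ANY theta-kernel datum
  `M : Weil1964.ThetaKernelDatum Mp SX GU ΓU G Γ` ([Weil1964, n° 41]: kernel `θ_Φ`, lift
  `M.thetaLift μ Φ f (ξ) = ∫_{G ⧸ Γ} θ_Φ(ξ, q) f(q) dμ(q)` of `ThetaLift.lean`, i.e. print's (4) in Mathlib's coset convention —
  `GU = G̃(A)` is the TARGET group, `G = G̃'(A)` the SOURCE), the three ingredients of (26): the Petersson pairing (9)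
  `quotPairing ν F₁ F₂ = ∫ F₁ \overline{F₂} dν` on `C(GU ⧸ ΓU, ℂ)`, the matrix coefficient `⟨π(h) f₁, f₂⟩` of the regular
  representation on `C(G ⧸ Γ, ℂ)` (`regularCoeff`; print's right translate `x ↦ f(xh)` of a LEFT-`G'(k)`-invariant function
  is the tree's `Weil1964.leftTranslate Γ h f : q ↦ f(h⁻¹ • q)` on the left-coset space, the dictionary of `ThetaLift.lean`
  §0/§4), and the integrand `h ↦ ⟨ω(h)Φ₁, Φ₂⟩ ⟨π(h) f₁, f₂⟩` (`rallisIntegrand`, with `ω(h) := M.W.act (M.s (1, h))` — the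
  datum's own action, cf. `ThetaKernelDatum.omg`) for a given sesquilinear pairing `ip` on `S(X_A)`; and the PROPERTY
  `M.RallisInnerProductIdentity ip dh μ ν` — «(26) holds for all `Φ₁ Φ₂ f₁ f₂`, the right-hand side converging absolutely,
  UP TO ONE POSITIVE CONSTANT `c` depending only on the four measures» (see «Constant» below).
* §2 the `L²(X(A))` pairing `⟨Φ₁, Φ₂⟩ = ∫ Φ₁ \overline{Φ₂} dν_X` on the tree's Schwartz–Bruhat space
  `Automorphic.piSchwartzBruhat F (Fin n) = 𝒮(𝔸_Fⁿ)` (print p. 178: «the realization of `ω` on `L²(X)` … The associated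
  space of smooth vectors is the Bruhat–Schwartz space `S(X(A))`»).
* §3 THE NAMED FACT `RallisInnerProductFormulaUnitaryDualPair` = Theorem 2.1 for the tree's constructed unitary dual pair:
  `E/F` a quadratic extension of number fields (print's case 2, `ε = 1/2`, so the printed range `n > 2n' + 4ε − 2` reads
  `N > 2M`), Gram data `J_V = T_V ⊗ 1`, `J_W = T_W ⊗ 1` of ranks `N = n`, `M = n'`, a COMPATIBLE pair splitting `s`
  ([GelbartRogawski1991, Prop. 3.1.1]; the tree's `UnitaryDualPair.splittingDatum … |>.IsCompatible s`), Weil's majorants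
  `hρ`, and the theta-kernel datum `UnitaryDualPair.thetaKernelDatum … s hs hρ SK hSK` of `UnitaryDualPairThetaKernel.lean`
  (kernel `θ_Φ(x, h) = Θ(ω_ψ(s_pair(x⁻¹, h⁻¹))Φ)`), with BOTH adelic quotients `[U(J_V)]`, `[U(J_W)]` compact (the
  anisotropic case — the only one in which the tree's `thetaLift` is defined), `μ`, `ν` finite invariant Borel measures
  charging open sets on them, `dh` a Haar measure on `U(J_W)(𝔸_F)`, `ν_X` an additive Haar measure on `𝔸_Fⁿ`, and the
  printed standing hypothesis that `ω` acts UNITARILY on `L²(X(A))` (p. 178; GR91 p. 454 L21–27: «`M_g` is an operator on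
  the space of `ρ_ψ`», unitary) made explicit as `hiso` — the tree's metaplectic group `adelicMpCont` has kernel `ℂˣ`, not
  `S¹` (`Weil1964/AdelicMetaplecticL2Scalar`: every operator is `L²`-isometric only up to a positive scalar), so unitarity
  along `s` is a genuine hypothesis on `s`, exactly print's.

SPECIALISATION (paper more general than the tree's carriers; `TODO(general form)` below): Li allows any type I dual pair
(`D = k`, quadratic, quaternion) and an ISOTROPIC `G'` with `π` CUSPIDAL; here `D = E` quadratic and `G' = U(J_W)`
anisotropic (`[U(J_W)]` compact), where every continuous `f` is cuspidal, the cuspidal spectrum is all of `L²`, and — both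
sides of (26) being continuous sesquilinear forms in `(f₁, f₂)` — the identity for smooth vectors of the irreducible
constituents `π ⊂ L²([U(J_W)])` (print) is equivalent to the identity for all continuous `f₁, f₂` (stated).  Nothing is
asserted for isotropic `W` or for metaplectic (genuine) `π`.

CONSTANT.  Print's (26) has no constant because its measures are tied to each other: `dx` on `G'(k)\G'(A)` is the quotient
of `dh` (p. 184), `dg` on `G(k)\G(A)` and the measure on `X(A)` are those of Weil's Siegel formula used in the proof
((15)–(25), pp. 182–184: self-dual measure for `ψ`, Tamagawa measure).  The tree's `thetaLift μ`, `quotPairing ν`,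
`regularCoeff μ` and `ν_X` take these four measures as free parameters (each canonical up to a positive scalar:
`UnitaryDualPairThetaLiftInvariantMeasure`, Haar uniqueness), so the faithful parameter-free reading of (26) is
«`∃ c > 0`, independent of `Φ₁ Φ₂ f₁ f₂`».  `TODO(constant)`: `c = 1` for the Siegel–Weil-normalised quadruple.

NOT here: the proof ((10)–(25): doubling, Weil's Siegel formula, the basic identity of Piatetski-Shapiro–Rallis), the
factorisation (27), §§3–5 (local integrals, Thm 5.4, Cor. 5.5, Thm 5.6 — the non-vanishing theorems), any regularised
(Kudla–Rallis / Ichino / Gan–Qiu–Takeda) extension beyond Weil's convergent range.  PROVED here (kernel, from the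
definitions): the diagonal case `‖Θ_Φ(f)‖² = c ∫ ⟨ω(h)Φ, Φ⟩⟨π(h)f, f⟩ dh` and print's «trivial observation» in the form
«right-hand side with positive real part ⇒ `Θ_Φ(f) ≠ 0`» (`RallisInnerProductIdentity.thetaLift_ne_zero_of_re_pos`).

## Mathlib / tree search

`lean search`/`rg`: `RallisInnerProduct` — only `Li1992/RallisInnerProduct.lean` (posited `Li92Datum`), range dictionaries
`Li1992/StableRange*`, `GanQiuTakeda2014/DoublingSetupRanges` (`RangeTriple.WeilConvergent`), and citations in
`GelbartRogawski1991/OscillatorTriple*`, `Liu2021/Prop413*`; no statement over `ThetaKernelDatum.thetaLift`.  Petersson-type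
pairings in the tree (`Automorphic.contWeightForms.petersson`, `PeterssonSpace`) live on weight-form carriers, not on
`C(GU ⧸ ΓU, ℂ)`; the `L²` structure of `𝒮(𝔸_Fⁿ)` is written `∫ Φ \overline{Ψ} dν` as in
`Automorphic.AdelicPiSchwartzBruhatPlancherel` (`integral_adelicPiFourier_mul_conj_adelicPiFourier`) and
`∫⁻ ‖Φ‖ₑ² dν` as in `Weil1964.AdelicMetaplecticL2Scalar` — both spellings are reused verbatim, no new carrier.

## References
* [Li1992] J.-S. Li, J. reine angew. Math. 428 (1992) 177–217, doi:10.1515/crll.1992.428.177 — (3)–(4) p. 178, (6)–(7)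
  p. 179, (9) p. 181, (24)–(25) and Theorem 2.1 (26)–(27) p. 184.
* [Weil1964] A. Weil, Acta Math. 111 (1964) 143–211, Chap. III n° 41 (the theta kernel; tree `ThetaKernelDatum`).
* [GelbartRogawski1991] S. Gelbart, J. Rogawski, Invent. Math. 105 (1991) 445–472, §3.1 p. 454 L21–27, Prop. 3.1.1 p. 455,
  §3.2 p. 457 (the unitary dual pair and its splitting; tree `UnitaryDualPair.thetaKernelDatum`).
* [FleigEtAl2018] P. Fleig, H. Gustafsson, A. Kleinschmidt, D. Persson, CUP (2018), §12.3 Def. 12.5 (12.37) (the lift;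
  tree `ThetaKernelDatum.thetaLift`).
-/

noncomputable section

open _root_.MeasureTheory NumberField
open scoped ComplexConjugate ENNReal
open Literature.NumberTheory.Weil1964 Literature.NumberTheory.Automorphic
open Literature.NumberTheory.GelbartRogawski1991

namespace Literature.NumberTheory.Li1992

universe u v

/-! ## §1 The two sides of (26) over a theta-kernel datum (generic; definitions only) -/

section Generic

variable {Mp : Type u} {SX : Type v} [TopologicalSpace Mp] [Group Mp] [TopologicalSpace SX]
variable {GU : Type*} [Group GU] [TopologicalSpace GU] {ΓU : Subgroup GU}
variable {G : Type*} [Group G] [TopologicalSpace G] {Γ : Subgroup G}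

/-- **The Petersson pairing** `⟨F₁, F₂⟩ = ∫_{G(k)\G(A)} F₁ \overline{F₂} dν` of two continuous functions on the (compact)
target quotient, print's (9), for a given finite Borel measure `ν` (linear in the FIRST variable, as in print).
[cite: Li1992, (9) p. 181] -/
def quotPairing [MeasurableSpace (GU ⧸ ΓU)] (ν : Measure (GU ⧸ ΓU)) (F₁ F₂ : C(GU ⧸ ΓU, ℂ)) : ℂ :=
  ∫ ξ, F₁ ξ * conj (F₂ ξ) ∂ν

/-- Unfolding `quotPairing`. [cite: Li1992, (9) p. 181] -/
theorem quotPairing_apply [MeasurableSpace (GU ⧸ ΓU)] (ν : Measure (GU ⧸ ΓU)) (F₁ F₂ : C(GU ⧸ ΓU, ℂ)) :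
    quotPairing ν F₁ F₂ = ∫ ξ, F₁ ξ * conj (F₂ ξ) ∂ν := rfl

/-- The Petersson pairing with the zero function on the left vanishes. [folklore] -/
private theorem quotPairing_zero_left [MeasurableSpace (GU ⧸ ΓU)] (ν : Measure (GU ⧸ ΓU)) (F₂ : C(GU ⧸ ΓU, ℂ)) :
    quotPairing ν 0 F₂ = 0 := by
  simp [quotPairing]

variable [IsTopologicalGroup G]

/-- **The matrix coefficient `⟨π(h) f₁, f₂⟩ = ∫_{G'(k)\G'(A)} f₁(xh) \overline{f₂(x)} dx`** of the regular representation of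
`G = G̃'(A)` on functions on the source quotient (print p. 184, after (24)), in the tree's coset convention: a
left-`G'(k)`-invariant `φ` on `G'(A)` is the function `f(xΓ) = φ(x⁻¹)` on `G ⧸ Γ`, and its right translate `x ↦ φ(xh)` is
`Weil1964.leftTranslate Γ h f = (q ↦ f(h⁻¹ • q))` (dictionary of `ThetaLift.lean` §0, §4). [cite: Li1992, p. 184 (24)–(25)] -/
def regularCoeff [MeasurableSpace (G ⧸ Γ)] (μ : Measure (G ⧸ Γ)) (h : G) (f₁ f₂ : C(G ⧸ Γ, ℂ)) : ℂ :=
  ∫ q, leftTranslate Γ h f₁ q * conj (f₂ q) ∂μ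

/-- Unfolding `regularCoeff`: `⟨π(h) f₁, f₂⟩ = ∫ f₁(h⁻¹ • q) \overline{f₂(q)} dμ(q)`. [cite: Li1992, p. 184 (24)–(25)] -/
theorem regularCoeff_apply [MeasurableSpace (G ⧸ Γ)] (μ : Measure (G ⧸ Γ)) (h : G) (f₁ f₂ : C(G ⧸ Γ, ℂ)) :
    regularCoeff μ h f₁ f₂ = ∫ q, f₁ (h⁻¹ • q) * conj (f₂ q) ∂μ := rfl

variable (M : ThetaKernelDatum Mp SX GU ΓU G Γ)

/-- **The integrand of (26)**: `h ↦ ⟨ω(h)Φ₁, Φ₂⟩ ⟨π(h) f₁, f₂⟩`, where `ω(h) := M.W.act (M.s (1, h))` is the theta-kernel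
datum's own action of the source group on `S(X_A)` (`ThetaKernelDatum.omg` on the index set) and `ip` is the `L²(X(A))`
pairing, supplied by the instance (§2 for the tree's `𝒮(𝔸_Fⁿ)`). [cite: Li1992, Thm 2.1 (26) p. 184] -/
def rallisIntegrand (ip : SX → SX → ℂ) [MeasurableSpace (G ⧸ Γ)] (μ : Measure (G ⧸ Γ)) (Φ₁ Φ₂ : SX)
    (f₁ f₂ : C(G ⧸ Γ, ℂ)) (h : G) : ℂ :=
  ip (M.W.act (M.s (1, h)) Φ₁) Φ₂ * regularCoeff μ h f₁ f₂

/-- Unfolding `rallisIntegrand`. [cite: Li1992, Thm 2.1 (26) p. 184] -/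
theorem rallisIntegrand_apply (ip : SX → SX → ℂ) [MeasurableSpace (G ⧸ Γ)] (μ : Measure (G ⧸ Γ)) (Φ₁ Φ₂ : SX)
    (f₁ f₂ : C(G ⧸ Γ, ℂ)) (h : G) :
    rallisIntegrand M ip μ Φ₁ Φ₂ f₁ f₂ h = ip (M.W.act (M.s (1, h)) Φ₁) Φ₂ * regularCoeff μ h f₁ f₂ := rfl

variable [IsTopologicalGroup GU]

/-- **Rallis' inner product identity for a theta-kernel datum, UP TO A POSITIVE CONSTANT** — the PROPERTY (a definition;
nothing is asserted here): there is `c > 0`, depending only on the datum and the four measures, such that for all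
`Φ₁ Φ₂ ∈ S(X_A)` and all continuous `f₁ f₂` on the source quotient the right-hand side of (26) converges absolutely and
`⟨Θ_{Φ₁}(f₁), Θ_{Φ₂}(f₂)⟩_ν = c · ∫_{G} ⟨ω(h)Φ₁, Φ₂⟩ ⟨π(h) f₁, f₂⟩_μ dh`.  This is print's (26) with the lift (4) =
`M.thetaLift μ` ([FleigEtAl2018, (12.37)]); see the module docstring, «Constant», for why `c` is existential.
[cite: Li1992, Thm 2.1 (26) p. 184] -/
def _root_.Literature.NumberTheory.Weil1964.ThetaKernelDatum.RallisInnerProductIdentity (ip : SX → SX → ℂ)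
    [MeasurableSpace G] (dh : Measure G) [CompactSpace (GU ⧸ ΓU)] [MeasurableSpace (G ⧸ Γ)] (μ : Measure (G ⧸ Γ))
    [MeasurableSpace (GU ⧸ ΓU)] (ν : Measure (GU ⧸ ΓU)) : Prop :=
  ∃ c : ℝ, 0 < c ∧ ∀ (Φ₁ Φ₂ : SX) (f₁ f₂ : C(G ⧸ Γ, ℂ)),
    Integrable (rallisIntegrand M ip μ Φ₁ Φ₂ f₁ f₂) dh ∧
      quotPairing ν (M.thetaLift μ Φ₁ f₁) (M.thetaLift μ Φ₂ f₂) =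
        (c : ℂ) * ∫ h, rallisIntegrand M ip μ Φ₁ Φ₂ f₁ f₂ h ∂dh

variable {M}

/-- **Diagonal case of (26)**: `‖Θ_Φ(f)‖²_ν = c ∫ ⟨ω(h)Φ, Φ⟩ ⟨π(h) f, f⟩ dh` (print's (5) p. 179 is its factorised
form). [cite: Li1992, Thm 2.1 (26) p. 184] -/
theorem _root_.Literature.NumberTheory.Weil1964.ThetaKernelDatum.RallisInnerProductIdentity.exists_normSq_eq
    {ip : SX → SX → ℂ} [MeasurableSpace G] {dh : Measure G} [CompactSpace (GU ⧸ ΓU)] [MeasurableSpace (G ⧸ Γ)]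
    {μ : Measure (G ⧸ Γ)} [MeasurableSpace (GU ⧸ ΓU)] {ν : Measure (GU ⧸ ΓU)}
    (hR : M.RallisInnerProductIdentity ip dh μ ν) :
    ∃ c : ℝ, 0 < c ∧ ∀ (Φ : SX) (f : C(G ⧸ Γ, ℂ)),
      quotPairing ν (M.thetaLift μ Φ f) (M.thetaLift μ Φ f) = (c : ℂ) * ∫ h, rallisIntegrand M ip μ Φ Φ f f h ∂dh := by
  obtain ⟨c, hc, h⟩ := hR
  exact ⟨c, hc, fun Φ f => (h Φ Φ f f).2⟩

/-- **Print's «trivial observation» (p. 178: `θ^f_φ` is non-zero iff its Petersson norm is), in the usable direction over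
the identity: if the right-hand side `∫ ⟨ω(h)Φ, Φ⟩ ⟨π(h) f, f⟩ dh` has positive real part, then the theta lift `Θ_Φ(f)` is
not the zero function.** [cite: Li1992, p. 178 and Thm 2.1 (26) p. 184] -/
theorem _root_.Literature.NumberTheory.Weil1964.ThetaKernelDatum.RallisInnerProductIdentity.thetaLift_ne_zero_of_re_pos
    {ip : SX → SX → ℂ} [MeasurableSpace G] {dh : Measure G} [CompactSpace (GU ⧸ ΓU)] [MeasurableSpace (G ⧸ Γ)]
    {μ : Measure (G ⧸ Γ)} [MeasurableSpace (GU ⧸ ΓU)] {ν : Measure (GU ⧸ ΓU)}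
    (hR : M.RallisInnerProductIdentity ip dh μ ν) {Φ : SX} {f : C(G ⧸ Γ, ℂ)}
    (hpos : 0 < (∫ h, rallisIntegrand M ip μ Φ Φ f f h ∂dh).re) :
    M.thetaLift μ Φ f ≠ 0 := by
  obtain ⟨c, hc, h⟩ := hR
  intro h0
  have key := (h Φ Φ f f).2
  rw [h0, quotPairing_zero_left] at key
  have hre := congrArg Complex.re key
  rw [Complex.zero_re, Complex.re_ofReal_mul] at hre
  exact (mul_pos hc hpos).ne' hre.symm

end Generic

/-! ## §2 The `L²(X(A))` pairing on the Schwartz–Bruhat space `𝒮(𝔸_Fⁿ)` -/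

section Schwartz

variable (F : Type) [Field F] [NumberField F] (ι : Type) [Fintype ι]
  [MeasurableSpace (AdeleRing (𝓞 F) F)] (νX : Measure (ι → AdeleRing (𝓞 F) F))

/-- **`⟨Φ₁, Φ₂⟩ = ∫_{X(A)} Φ₁ \overline{Φ₂} dν_X`** on `S(X(A)) = 𝒮(𝔸_Fⁿ)` (the tree's `piSchwartzBruhat F ι`), the inner
product of the Schrödinger model `L²(X)` restricted to its smooth vectors (print p. 178; p. 182 (13)); linear in the first
variable as in print. [cite: Li1992, p. 178 and (13) p. 182] -/
def schwartzPairing (Φ₁ Φ₂ : piSchwartzBruhat F ι) : ℂ :=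
  ∫ x, (Φ₁ : (ι → AdeleRing (𝓞 F) F) → ℂ) x * conj ((Φ₂ : (ι → AdeleRing (𝓞 F) F) → ℂ) x) ∂νX

/-- Unfolding `schwartzPairing`. [cite: Li1992, p. 178] -/
theorem schwartzPairing_apply (Φ₁ Φ₂ : piSchwartzBruhat F ι) :
    schwartzPairing F ι νX Φ₁ Φ₂ =
      ∫ x, (Φ₁ : (ι → AdeleRing (𝓞 F) F) → ℂ) x * conj ((Φ₂ : (ι → AdeleRing (𝓞 F) F) → ℂ) x) ∂νX := rfl

end Schwartz

/-! ## §3 Theorem 2.1 for the constructed unitary dual pair `(U(J_V), U(J_W))`, `N > 2M` — THE NAMED FACT -/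

/-- **[Li1992, Theorem 2.1] — Rallis' inner product formula in Weil's convergent range, for the tree's unitary dual pair.**
AS PRINTED (p. 184): «Let `φ₁, φ₂ ∈ S(X(A))`; `f₁, f₂ ∈ π`. Assume `n > 2n' + 4ε − 2`. Then
(26) `⟨θ^{f₁}_{φ₁}, θ^{f₂}_{φ₂}⟩ = ∫_{G̃'(A)} ⟨ω(h)φ₁, φ₂⟩ ⟨π(h) f₁, f₂⟩ dh`», with
`⟨π(h) f₁, f₂⟩ = ∫_{G'(k)\G'(A)} f₁(xh) \overline{f₂(x)} dx` and `⟨·,·⟩` on the left the Petersson product (9) on `G(k)\G(A)`.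
READ HERE for: `k = F`, `D = E` a quadratic extension (case 2: `ε = 1/2`, so the range is `n > 2n'`, i.e. `2 * M < N`),
`G = U(J_V)` of rank `n = N` (the TARGET `GU` of the datum), `G' = U(J_W)` of rank `n' = M` (the SOURCE), Gram data
`J_V = T_V ⊗ 1`, `J_W = T_W ⊗ 1` with a compatible pair splitting `s` ([GelbartRogawski1991, Prop. 3.1.1]) — so `π` is a
representation of `U(J_W)(𝔸_F)` itself, no genuine cover —, Weil's majorants `hρ`, an `U(J_W)(𝔸_F)`-stable index set `SK`,
and the CONSTRUCTED kernel/lift `UnitaryDualPair.thetaKernelDatum … s hs hρ SK hSK` / `ThetaKernelDatum.thetaLift μ`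
([Weil1964, n° 41]; [FleigEtAl2018, (12.37)] = print's (3)–(4)); both quotients `[U(J_V)]`, `[U(J_W)]` COMPACT, `μ`, `ν`
finite invariant Borel measures charging open sets on them, `dh` a Haar measure on `U(J_W)(𝔸_F)`, `ν_X` an additive Haar
measure on `X(A) = 𝔸_Fⁿ` (`n = N·M`), and `ω = ω_ψ ∘ s_pair` UNITARY for `L²(X(A), ν_X)` on `S(X(A))` (`hiso`, print's
standing assumption p. 178).  CONCLUSION: `RallisInnerProductIdentity` of §1 — (26) for all `Φ₁ Φ₂ ∈ 𝒮(𝔸_Fⁿ)` and all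
continuous `f₁ f₂` on `[U(J_W)]`, absolutely convergent right-hand side, up to one positive constant fixed by the four
measures (module docstring «Constant», «Specialisation»).
`TODO(general form)`: isotropic `W` (cuspidal `π`, `[U(J_W)]` non-compact), general type I pairs (`D = k`, quaternion `D`),
genuine `π` of the metaplectic cover; `TODO(constant)`: `c = 1` for Siegel–Weil-normalised measures.
[cite: Li1992, Thm 2.1 (26) p. 184] -/
def RallisInnerProductFormulaUnitaryDualPair : Prop :=
  ∀ (F E : Type) [Field F] [NumberField F] [Field E] [NumberField E] [Algebra F E]
    (c : E ≃ₐ[F] E) (N M : ℕ) {n : ℕ} (e : Fin N × Fin M ≃ Fin n)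
    (JV : Matrix (Fin N) (Fin N) E) (JW : Matrix (Fin M) (Fin M) E)
    {TV : Matrix (Fin N) (Fin N) F} {TW : Matrix (Fin M) (Fin M) F}
    [Algebra.IsQuadraticExtension F E] {δ : E} (hcδ : c δ = -δ) (hδ : δ ≠ 0) {d : F}
    (hd : δ * δ = algebraMap F E d) (hV : TV.IsSymm) (hW : TW.IsSymm) (hVd : IsUnit TV.det) (hWd : IsUnit TW.det)
    (hJV : JV = TV.map (algebraMap F E)) (hJW : JW = TW.map (algebraMap F E))
    [LocallyCompactSpace (UnitaryGroup.adelic F E c N JV)] [LocallyCompactSpace (UnitaryGroup.adelic F E c M JW)]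
    (s : UnitaryGroup.adelicPair F E c N M JV JW →* adelicMpCont F (Fin n) (UnitaryDualPair.adelicGram F e TV TW))
    (hs : (UnitaryDualPair.splittingDatum F E c N M e JV JW hcδ hδ hd hV hW hVd hWd hJV hJW).IsCompatible s)
    (hρ : HasThetaMajorants fun (p : UnitaryGroup.adelic F E c N JV × UnitaryGroup.adelic F E c M JW)
      (Φ : piSchwartzBruhat F (Fin n)) => UnitaryDualPair.pairRep F E c N M e JV JW s p Φ)
    (SK : Set (piSchwartzBruhat F (Fin n)))
    (hSK : ∀ (h : UnitaryGroup.adelic F E c M JW) (Φ : piSchwartzBruhat F (Fin n)), Φ ∈ SK →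
      UnitaryDualPair.pairRep F E c N M e JV JW s (1, h) Φ ∈ SK)
    -- the four measures
    [MeasurableSpace (AdeleRing (𝓞 F) F)] [BorelSpace (AdeleRing (𝓞 F) F)]
    (νX : Measure (Fin n → AdeleRing (𝓞 F) F)) [νX.IsAddHaarMeasure]
    [MeasurableSpace (UnitaryGroup.adelic F E c M JW)] [BorelSpace (UnitaryGroup.adelic F E c M JW)]
    (dh : Measure (UnitaryGroup.adelic F E c M JW)) [dh.IsHaarMeasure]
    [CompactSpace (UnitaryGroup.adelic F E c N JV ⧸ (UnitaryGroup.toAdelic F E c N JV).range)]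
    [CompactSpace (UnitaryGroup.adelic F E c M JW ⧸ (UnitaryGroup.toAdelic F E c M JW).range)]
    [MeasurableSpace (UnitaryGroup.adelic F E c M JW ⧸ (UnitaryGroup.toAdelic F E c M JW).range)]
    [BorelSpace (UnitaryGroup.adelic F E c M JW ⧸ (UnitaryGroup.toAdelic F E c M JW).range)]
    (μ : Measure (UnitaryGroup.adelic F E c M JW ⧸ (UnitaryGroup.toAdelic F E c M JW).range))
    [IsFiniteMeasure μ] [μ.IsOpenPosMeasure]
    [SMulInvariantMeasure (UnitaryGroup.adelic F E c M JW)
      (UnitaryGroup.adelic F E c M JW ⧸ (UnitaryGroup.toAdelic F E c M JW).range) μ]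
    [MeasurableSpace (UnitaryGroup.adelic F E c N JV ⧸ (UnitaryGroup.toAdelic F E c N JV).range)]
    [BorelSpace (UnitaryGroup.adelic F E c N JV ⧸ (UnitaryGroup.toAdelic F E c N JV).range)]
    (ν : Measure (UnitaryGroup.adelic F E c N JV ⧸ (UnitaryGroup.toAdelic F E c N JV).range))
    [IsFiniteMeasure ν] [ν.IsOpenPosMeasure]
    [SMulInvariantMeasure (UnitaryGroup.adelic F E c N JV)
      (UnitaryGroup.adelic F E c N JV ⧸ (UnitaryGroup.toAdelic F E c N JV).range) ν],
    -- print's standing hypothesis: `ω = ω_ψ ∘ s_pair` is unitary for `L²(X(A), ν_X)` on `S(X(A))`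
    (∀ (p : UnitaryGroup.adelic F E c N JV × UnitaryGroup.adelic F E c M JW) (Φ : piSchwartzBruhat F (Fin n)),
      ∫⁻ x, ‖(UnitaryDualPair.pairRep F E c N M e JV JW s p Φ : (Fin n → AdeleRing (𝓞 F) F) → ℂ) x‖ₑ ^ 2 ∂νX =
        ∫⁻ x, ‖(Φ : (Fin n → AdeleRing (𝓞 F) F) → ℂ) x‖ₑ ^ 2 ∂νX) →
    -- print's range `n > 2n' + 4ε − 2` with `ε = 1/2`
    2 * M < N →
    (UnitaryDualPair.thetaKernelDatum F E c N M e JV JW hcδ hδ hd hV hW hVd hWd hJV hJW s hs hρ SK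
        hSK).RallisInnerProductIdentity (schwartzPairing F (Fin n) νX) dh μ ν

end Literature.NumberTheory.Li1992
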